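import Summits.BirchSwinnertonDyer.BirchSwinnertonDyer.Theorems.EisensteinPrimesMazurMCOnX1RankZeroMuEtaleEnd
import Literature.NumberTheory.EllipticCurves.GlobalMinimalModelProofs
import Literature.NumberTheory.EllipticCurves.IsogenyVariableChangeProofs
import HarnessLib

/-!
# Crux `MazurMCOnX1RankZero` (stmt-BirchSwinnertonDyer-19035), line `mudescent`, stub
# `stub_analyticMuZero_offLocus` — Greenberg's Conjecture 1.11 in the EXACT SHAPE of the typing
# layer's conjecture leaf implies the stub, modulo the μ-part of Mazur's main conjecture at the
# étale ends (cell `bsd-eis`, seat `bsd-eis-mu-b`, gen 2; CONSTRUCTION seat — closes NO stub)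

The typing layer (bsd-littype-11) has staged Greenberg's `μ`-conjecture as a pure conjecture leaf
`GreenbergMuConjecture` with the body (verbatim)

  `∀ (W : WeierstrassCurve ℚ) [W.IsElliptic] (p : ℕ) [Fact p.Prime] (κ : ZpExtension ℚ p)
     (γ : Field.absoluteGaloisGroup ℚ), κ.IsCyclotomic → κ.IsTopGenerator γ →
     ∀ D : W.SelmerDualData κ γ, D.IsTorsion →
       ∃ (W' : WeierstrassCurve ℚ) (_ : W'.IsElliptic), W.IsIsogenous W' ∧
         ∀ D' : W'.SelmerDualData κ γ, D'.IsTorsion → D'.mu = 0`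

— `W′` merely elliptic (not globally minimal), `D.IsTorsion →` displayed, and `W′` allowed to depend
on `(κ, γ, D)`. The leaf is not in the tree yet, so this file takes that body as a displayed
HYPOTHESIS `hG` (nothing is asserted) and proves that on the rank-`0` X1 classes it gives the located
form (G_loc) used by line `mudescent` — hence, with the μ-part of the main conjecture at the
off-locus members, the registered stub (`stub_of_greenbergMuShape_of_muPart`). The three shape
differences are discharged by tree theorems: a global minimal model `C • W′` exists
(`hasGlobalMinimalModel_rat_holds`, Néron) and `W′ → C • W′` is an isogeny of degree `1`
(`VariableChange.toIsogeny`, `degree_toIsogeny`), along which `μ` is invariant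
(`mu_eq_of_isogeny_not_dvd_degree`, p471995); every dual datum on the leaf is torsion
(`isTorsion_of_leaf`); and the dependence of `W′` on `(κ, γ, D)` is harmless because a `μ = 0` member
is off the locus POINTWISE in `(κ, γ)` (`EisensteinMuBarrier.mu_ne_zero`, Prop. 5.7) and two
off-locus members have equal `μ` (`mu_eq_of_offLocus_of_offLocus`, p471995).

So `--conditional-on GreenbergMuConjecture` for stub 4 of `mudescent` is now kernel-exact up to
(M): `GreenbergMuConjecture → (M at the étale ends) → stub` (instantiate `hG` with the leaf's decl).
HONEST FRAMING: theorems only; `hG` is Greenberg's OPEN conjecture displayed as a hypothesis, not a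
fact; (M) is the crux / KY24 (PRE); closes nothing; no label or count of the cell moves. References:
[GreenbergLNM1716] Conj. 1.11 (p. 58), Prop. 5.7 (p. 113); [Neron1964] (minimal models);
[SilvermanAEC2009] VIII.8.3, III.3.1(b); [Wuthrich2014] Thm. 16; [BCDTJAMS2001] Thm. A; HOME
`run/shared/lean/pub/bsd-eis/mu-b-MEMO-2.md`; staged leaf
`run/shared/lean/pub/bsd-littype/staging/bsd-littype-11/GreenbergMuConjecture.lean`.
-/

set_option autoImplicit false

-- `Summit.BirchSwinnertonDyer.BirchSwinnertonDyer.…`: the summit and its single sub-problem share a name (D-0017 layout).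
set_option linter.dupNamespace false

noncomputable section

open scoped Classical

open WeierstrassCurve Field
  Literature.NumberTheory.EllipticCurves Literature.NumberTheory.EllipticCurves.Rank1Residual
  Literature.NumberTheory.EllipticCurves.ModularForms
  Literature.NumberTheory.EllipticCurves.Greenberg1999
  Literature.Barriers.BirchSwinnertonDyer
  Summit.BirchSwinnertonDyer.Rank1Residual
  Summit.BirchSwinnertonDyer.BirchSwinnertonDyer.Theorems
  Summit.BirchSwinnertonDyer.BirchSwinnertonDyer.Theorems.EisensteinPrimesMazurMCOnX1RankZeroAnalyticMuMinimal
  Summit.BirchSwinnertonDyer.BirchSwinnertonDyer.Theorems.EisensteinPrimesMazurMCOnX1RankZeroAnalyticMuIsogenyForm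
  Summit.BirchSwinnertonDyer.BirchSwinnertonDyer.Theorems.EisensteinPrimesMazurMCOnX1RankZeroMuEtaleEnd

namespace Summit.BirchSwinnertonDyer.BirchSwinnertonDyer.Theorems.EisensteinPrimesMazurMCOnX1RankZeroGreenbergMuShape

/-! ## §1. The conjecture leaf's shape ⇒ the located form (G_loc) on the rank-`0` X1 classes -/

/-- **Greenberg's Conj. 1.11, in the exact shape of the typing layer's leaf, gives `μ = 0` at every
off-locus rank-`0` X1 member** (granted Prop. 5.7 `h57`, Wuthrich Thm. 16 `hW16`, modularity
`hmod`). Given an off-locus leaf member `W₀`, cyclotomic data `(κ, γ)` and a dual datum `D₀` (torsion,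
`isTorsion_of_leaf`): `hG` yields an isogenous elliptic `W′` with `μ = 0` for its torsion data over
`(κ, γ)`; pass to a global minimal model `W″ = C • W′` (`hasGlobalMinimalModel_rat_holds`) along the
degree-`1` isogeny `VariableChange.toIsogeny` (`μ` and torsion transported by p471995 §1 and the
tree's char-ideal balance); `W″` is a leaf member with `μ(D″) = 0`, hence off the locus pointwise
(`EisensteinMuBarrier.mu_ne_zero`), hence `μ(D₀) = μ(D″) = 0` (`mu_eq_of_offLocus_of_offLocus`).
[cite: GreenbergLNM1716, Conj. 1.11 (p. 58) and Prop. 5.7 (p. 113)] [cite: SilvermanAEC2009, VIII.8.3 and III.3.1(b)]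
[cite: Wuthrich2014, Thm. 16 (p. 397)] [cite: BCDTJAMS2001, Theorem A] -/
theorem mu_eq_zero_offLocus_of_greenbergMuShape
    (h57 : prop57_one_le_mu_of_ramified_odd_line) (hW16 : Wuthrich2014.charIdeal_dvd_padicLFunction)
    (hmod : nonempty_modularParametrizationData)
    (hG : ∀ (W : WeierstrassCurve ℚ) [W.IsElliptic] (p : ℕ) [Fact p.Prime]
      (κ : ZpExtension ℚ p) (γ : Field.absoluteGaloisGroup ℚ),
      κ.IsCyclotomic → κ.IsTopGenerator γ →
      ∀ D : W.SelmerDualData κ γ, D.IsTorsion →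
        ∃ (W' : WeierstrassCurve ℚ) (_ : W'.IsElliptic), W.IsIsogenous W' ∧
          ∀ D' : W'.SelmerDualData κ γ, D'.IsTorsion → D'.mu = 0)
    (W₀ : WeierstrassCurve ℚ) [W₀.IsElliptic] [W₀.IsGloballyMinimal] (p : ℕ) [Fact p.Prime]
    (hX1 : ClassX1 W₀ p) (hr0 : W₀.analyticRank = 0) (hoff : ¬ HasRamifiedOddLineAt W₀ p)
    {κ : ZpExtension ℚ p} {γ : Field.absoluteGaloisGroup ℚ} (hκ : κ.IsCyclotomic)
    (hγ : κ.IsTopGenerator γ) (hγ' : IsCyclotomicVariable p γ) (D₀ : W₀.SelmerDualData κ γ) :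
    D₀.mu = 0 := by
  have hpP : p.Prime := Fact.out
  have hL₀ : X1.RankZero.Leaf W₀ p := ⟨hX1, hr0⟩
  have hD₀ : D₀.IsTorsion := isTorsion_of_leaf hW16 hmod hL₀ hκ hγ hγ' D₀
  obtain ⟨W', hE', hiso', hμ'⟩ := hG W₀ p κ γ hκ hγ D₀ hD₀
  haveI := hE'
  -- a global minimal model `W'' = C • W'` and the degree-one isogeny `W' → W''`
  obtain ⟨C, hmin⟩ := hasGlobalMinimalModel_rat_holds W'
  haveI := hmin
  set ι : Isogeny W' (C • W') := VariableChange.toIsogeny W' C with hιdef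
  have hιdeg : ¬ p ∣ ι.degree := by
    rw [hιdef, VariableChange.degree_toIsogeny]
    exact hpP.not_dvd_one
  have hiso'' : IsIsogenous W₀ (C • W') := hiso'.trans' ⟨ι⟩
  -- dual data for `W'` and `W''`, torsion and `μ = 0`
  obtain ⟨D'⟩ := W'.nonempty_selmerDualData_holds κ γ hγ
  obtain ⟨D''⟩ := (C • W').nonempty_selmerDualData_holds κ γ hγ
  have hD' : D'.IsTorsion := (D₀.isTorsion_and_charIdeal_mul_span_eq_of_isIsogenous D' hiso' hγ hD₀).1
  obtain ⟨hD'', hμ''⟩ := isTorsion_and_mu_eq_of_isogeny_not_dvd_degree ι hιdeg hγ D' D'' hD'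
  have hμ''0 : D''.mu = 0 := by rw [hμ'', hμ' D' hD']
  -- `W''` is a leaf member, off the locus (Prop. 5.7, pointwise in `(κ, γ)`)
  have hL'' : X1.RankZero.Leaf (C • W') p := leaf_of_isIsogenous hX1 hr0 hiso''.symm_of_charZero
  have hX'' := isClassX1_of_classX1 hL''.classX1
  haveI : Module.Finite (IwasawaAlgebra p) D''.X := D''.module_finite_holds hγ
  have hoff'' : ¬ HasRamifiedOddLineAt (C • W') p := fun hloc ↦
    EisensteinMuBarrier.mu_ne_zero h57 hX''.two_ne (Or.inl hL''.goodOrd) hloc hκ hγ D'' hD'' hμ''0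
  -- two off-locus members have the same `μ`
  rw [← mu_eq_of_offLocus_of_offLocus hX1 hr0 hoff hiso'' hoff'' D₀ D'', hμ''0]

/-- **The leaf's shape ⇒ (G_loc)** in the class-wide form consumed by p462224 / p468995 / p471995.
[cite: GreenbergLNM1716, Conj. 1.11 (p. 58) and Prop. 5.7 (p. 113)] [cite: Wuthrich2014, Thm. 16 (p. 397)] -/
theorem greenbergMu_located_of_greenbergMuShape
    (h57 : prop57_one_le_mu_of_ramified_odd_line) (hW16 : Wuthrich2014.charIdeal_dvd_padicLFunction)
    (hmod : nonempty_modularParametrizationData)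
    (hG : ∀ (W : WeierstrassCurve ℚ) [W.IsElliptic] (p : ℕ) [Fact p.Prime]
      (κ : ZpExtension ℚ p) (γ : Field.absoluteGaloisGroup ℚ),
      κ.IsCyclotomic → κ.IsTopGenerator γ →
      ∀ D : W.SelmerDualData κ γ, D.IsTorsion →
        ∃ (W' : WeierstrassCurve ℚ) (_ : W'.IsElliptic), W.IsIsogenous W' ∧
          ∀ D' : W'.SelmerDualData κ γ, D'.IsTorsion → D'.mu = 0) :
    ∀ (W₀ : WeierstrassCurve ℚ) [W₀.IsElliptic] [W₀.IsGloballyMinimal] (p : ℕ) [Fact p.Prime],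
      ClassX1 W₀ p → W₀.analyticRank = 0 → ¬ HasRamifiedOddLineAt W₀ p →
      ∀ (κ : ZpExtension ℚ p) (γ : Field.absoluteGaloisGroup ℚ),
        κ.IsCyclotomic → κ.IsTopGenerator γ → IsCyclotomicVariable p γ →
        ∀ D : W₀.SelmerDualData κ γ, D.mu = 0 :=
  fun W₀ _ _ p _ hX1 hr0 hoff _ _ hκ hγ hγ' D ↦
    mu_eq_zero_offLocus_of_greenbergMuShape h57 hW16 hmod hG W₀ p hX1 hr0 hoff hκ hγ hγ' D

/-! ## §2. `GreenbergMuConjecture`-shape ∧ (M) at the étale ends ⇒ the registered stub -/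

/-- **`--conditional-on GreenbergMuConjecture`, kernel-exact up to (M).** Granted Greenberg LNM 1716
Prop. 5.7 (`h57`), Wuthrich 2014 Thm. 16 (`hW16`), modularity (`hmod`), the μ-part of Mazur's main
conjecture `MuPartAt` at every off-locus rank-`0` X1 member (`hM`: the μ-half of line `katoky`'s
`stub_muLambda`; Keller–Yin Thm. 3.0.10 would give it, PREPRINT) and Greenberg's Conj. 1.11 in the
exact shape of the typing layer's conjecture leaf (`hG`, displayed — OPEN, nothing asserted):
`stub_analyticMuZero_offLocus` (the conclusion, verbatim the registered signature). Chain: `hG` ⇒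
(G_loc) (§1) ⇒ with (M) the certificate `μ_an = 0` at every off-locus member (p462224
`stub_iff_muPart_and_greenbergMu_offLocus`). [cite: GreenbergLNM1716, Conj. 1.11 (p. 58) and Prop. 5.7 (p. 113)]
[cite: Wuthrich2014, Thm. 16 (p. 397)] [cite: KellerYin2024, Thm. 3.0.10 (preprint claim)] [cite: BCDTJAMS2001, Theorem A] -/
theorem stub_of_greenbergMuShape_of_muPart
    (h57 : prop57_one_le_mu_of_ramified_odd_line) (hW16 : Wuthrich2014.charIdeal_dvd_padicLFunction)
    (hmod : nonempty_modularParametrizationData)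
    (hM : ∀ (W₀ : WeierstrassCurve ℚ) [W₀.IsElliptic] [W₀.IsGloballyMinimal] (p : ℕ) [Fact p.Prime],
      ClassX1 W₀ p → W₀.analyticRank = 0 → ¬ HasRamifiedOddLineAt W₀ p → X1.MuLambda.MuPartAt W₀ p)
    (hG : ∀ (W : WeierstrassCurve ℚ) [W.IsElliptic] (p : ℕ) [Fact p.Prime]
      (κ : ZpExtension ℚ p) (γ : Field.absoluteGaloisGroup ℚ),
      κ.IsCyclotomic → κ.IsTopGenerator γ →
      ∀ D : W.SelmerDualData κ γ, D.IsTorsion →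
        ∃ (W' : WeierstrassCurve ℚ) (_ : W'.IsElliptic), W.IsIsogenous W' ∧
          ∀ D' : W'.SelmerDualData κ γ, D'.IsTorsion → D'.mu = 0) :
    ∀ (W₀ : WeierstrassCurve ℚ) [W₀.IsElliptic] [W₀.IsGloballyMinimal] (p : ℕ) [Fact p.Prime],
      ClassX1 W₀ p → W₀.analyticRank = 0 → ¬ HasRamifiedOddLineAt W₀ p →
        X1.MuPart.AnalyticMuLE W₀ p 0 :=
  (stub_iff_muPart_offLocus_and_greenbergMu h57 hW16 hmod).1.mpr
    ⟨hM, greenbergMu_located_of_greenbergMuShape h57 hW16 hmod hG⟩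

/-- **Conversely, the stub gives the leaf-restricted instance of the conjecture's shape** (granted
Thm. 16 and modularity): for a rank-`0` X1 pair and any cyclotomic `(κ, γ)` matching the cyclotomic
variable, SOME `ℚ`-isogenous elliptic `W′` (the étale end of `stub_locate`) has `μ = 0` for every
dual datum — the conclusion of Conj. 1.11 for these `(E, p)`, with the witness independent of the
datum. (Restatement of p460164 `greenbergMu_onLeaf_of_stub` in the leaf's binder order.)
[cite: GreenbergLNM1716, Conj. 1.11 (p. 58)] [cite: Wuthrich2014, Thm. 16 (p. 397)] -/
theorem greenbergMuShape_onLeaf_of_stub (hW16 : Wuthrich2014.charIdeal_dvd_padicLFunction)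
    (hmod : nonempty_modularParametrizationData)
    (hstub : ∀ (W₀ : WeierstrassCurve ℚ) [W₀.IsElliptic] [W₀.IsGloballyMinimal] (p : ℕ) [Fact p.Prime],
      ClassX1 W₀ p → W₀.analyticRank = 0 → ¬ HasRamifiedOddLineAt W₀ p →
        X1.MuPart.AnalyticMuLE W₀ p 0)
    (W : WeierstrassCurve ℚ) [W.IsElliptic] [W.IsGloballyMinimal] (p : ℕ) [Fact p.Prime]
    (hX1 : ClassX1 W p) (hr0 : W.analyticRank = 0)
    (κ : ZpExtension ℚ p) (γ : Field.absoluteGaloisGroup ℚ) (hκ : κ.IsCyclotomic)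
    (hγ : κ.IsTopGenerator γ) (hγ' : IsCyclotomicVariable p γ) :
    ∃ (W' : WeierstrassCurve ℚ) (_ : W'.IsElliptic), W.IsIsogenous W' ∧
      ∀ D' : W'.SelmerDualData κ γ, D'.IsTorsion → D'.mu = 0 := by
  obtain ⟨W₀, hE₀, hmin₀, hiso, -, hμ⟩ :=
    EisensteinPrimesMazurMCOnX1RankZeroAnalyticMuOffLocus.greenbergMu_onLeaf_of_stub hW16 hmod hstub
      W p hX1 hr0
  exact ⟨W₀, hE₀, hiso, fun D' _ ↦ (hμ κ γ hκ hγ hγ' D').2⟩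

end Summit.BirchSwinnertonDyer.BirchSwinnertonDyer.Theorems.EisensteinPrimesMazurMCOnX1RankZeroGreenbergMuShape

end
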